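/-
Copyright (c) 2026. All rights reserved.
Released under Apache 2.0 license as described in the file LICENSE.
Authors: abc-iut cell, wave-2 seat abc-iut-L3-t11 (proof-only; row «P4-NAT»: the group-theoretic core of the
naturality of the double-coset dictionary of [SemiAnbd] Def 2.2 (i) under a tower of coverings).
-/
import Mathlib.GroupTheory.Index
import Mathlib.GroupTheory.DoubleCoset
import Mathlib.Algebra.Group.Subgroup.Pointwise
import HarnessLib

/-!
# [SemiAnbd] Def 2.2 (i): naturality of the branch dictionary under a tower — the group-theoretic core

Mochizuki, *Semi-graphs of anabelioids*, Publ. RIMS **42** (2006) [MochizukiSemiAnbd2006], Definition 2.2 (i)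
p. 23 (for a finite étale covering `𝒢' → 𝒢`, a vertex `v'` over `v` and a branch `b ∋ v`: the branches `b'`
over `b` at `v'` correspond to the double cosets `Π_{v'}\Π_v/Π_b`, with `Π_{b'} = Π_{v'} ∩ x·Π_b·x⁻¹` for
`x` in the double coset of `b'` — the tree's named fact `covering_branchFibre_doubleCosets`, proved by seat
L6-t17), Definition 2.4 (iv) p. 26 (aloof: `Π_b ∩ g·Π_b·g⁻¹` has infinite index in `Π_b` for `g ∉ Π_b`).

For a TOWER `𝒢_j → 𝒢_i → 𝒢` (`v_j ↦ v_i ↦ v`, `b_j ↦ b_i ↦ b`) the dictionaries are COMPATIBLE: the double coset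
`Π_{v_j} x_j Π_b` of `b_j` lies in the double coset `Π_{v_i} x_i Π_b` of `b_i` (producer obligation (P4) = (DN)
of `TemperedLevelDictionary.lean`). This PROOF-ONLY file isolates the group-theoretic heart, free of
anabelioids: in a group `Π` with subgroups `R_j` of FINITE INDEX (`= Π_{v_j}`), `R_i` (`= Π_{v_i}`), `P` (`= Π_b`,
ALOOF), if `R_j ∩ x_j P x_j⁻¹` (`= Π_{b_j}`, the level-`j` clause) lies in `r·(x_i P x_i⁻¹)·r⁻¹` for some
`r ∈ R_i` (the image of `Π_{b_j} ≤ x_{ji} Π_{b_i} x_{ji}⁻¹` under `Π_{v_i} ↪ Π_v`, combined with the level-`i`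
clause), then `x_j ∈ R_i · x_i · P` (`mem_doubleCoset_of_inf_conj_le`): the finite-index subgroup
`R_j ∩ P^{x_j}` of `P^{x_j}` lies in `P^{r x_i}`, so `P ∩ P^{x_j⁻¹ r x_i}` has finite index in `P`, and
aloofness forces `x_j⁻¹ r x_i ∈ P`. What remains for (P4) in either presentation is bookkeeping (the three
clauses and the inclusion of branch groups along `𝒢_j → 𝒢_i`). No definitions.
-/

namespace Literature.AnabelianGeometry.SemiGraphs

open scoped Pointwise

universe u

variable {G : Type u} [Group G]

/-- **Aloofness pins a conjugator into `P`**: if `P` is aloof (`P ∩ gPg⁻¹` has infinite index in `P` for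
`g ∉ P`) and `P ∩ gPg⁻¹` has FINITE index in `P`, then `g ∈ P`. [cite: MochizukiSemiAnbd2006, Def. 2.4(iv) p.26] -/
theorem mem_of_relIndex_conj_ne_zero {P : Subgroup G}
    (haloof : ∀ g : G, g ∉ P → (P.map (MulAut.conj g).toMonoidHom).relIndex P = 0) {g : G}
    (hfin : (P.map (MulAut.conj g).toMonoidHom).relIndex P ≠ 0) : g ∈ P := by
  by_contra hg
  exact hfin (haloof g hg)

/-- Conjugating the pair `(P^{a}, P^{c})` back by `a`: the relative index of `P^{c}` in `P^{a}` is that of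
`P^{a⁻¹c}` in `P`. [cite: MochizukiSemiAnbd2006, Def. 2.2(i) p.23] -/
theorem relIndex_map_conj_map_conj (P : Subgroup G) (a c : G) :
    (P.map (MulAut.conj c).toMonoidHom).relIndex (P.map (MulAut.conj a).toMonoidHom) =
      (P.map (MulAut.conj (a⁻¹ * c)).toMonoidHom).relIndex P := by
  have h1 : (MulAut.conj c).toMonoidHom =
      (MulAut.conj a).toMonoidHom.comp (MulAut.conj (a⁻¹ * c)).toMonoidHom := by
    ext x; simp [mul_assoc]
  rw [h1, ← Subgroup.map_map]
  exact Subgroup.relIndex_map_map_of_injective (f := (MulAut.conj a).toMonoidHom)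
    (P.map (MulAut.conj (a⁻¹ * c)).toMonoidHom) P (MulAut.conj a).injective

/-- **Naturality of the double-coset dictionary, group-theoretic core** (Def 2.2 (i) under a tower
`𝒢_j → 𝒢_i → 𝒢`): `R_j ≤ Π` of finite index (`Π_{v_j}`), `R_i ∋ r` (`Π_{v_i}`), `P` aloof (`Π_b`); if the
level-`j` branch group `R_j ∩ x_j P x_j⁻¹` lies in `r·(x_i P x_i⁻¹)·r⁻¹`, then `x_j ∈ R_i · x_i · P` — the double
coset of `b_j` lies in that of its image `b_i`. [cite: MochizukiSemiAnbd2006, Def. 2.2(i) p.23] -/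
theorem mem_doubleCoset_of_inf_conj_le {R_i R_j P : Subgroup G} [R_j.FiniteIndex]
    (haloof : ∀ g : G, g ∉ P → (P.map (MulAut.conj g).toMonoidHom).relIndex P = 0)
    {x_i x_j r : G} (hr : r ∈ R_i)
    (hle : R_j ⊓ P.map (MulAut.conj x_j).toMonoidHom ≤
      (P.map (MulAut.conj x_i).toMonoidHom).map (MulAut.conj r).toMonoidHom) :
    x_j ∈ (R_i : Set G) * {x_i} * (P : Set G) := by
  -- `R_j ∩ P^{x_j}` has finite index in `P^{x_j}`
  have hfin₁ : (R_j ⊓ P.map (MulAut.conj x_j).toMonoidHom).relIndex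
      (P.map (MulAut.conj x_j).toMonoidHom) ≠ 0 := by
    rw [Subgroup.inf_relIndex_right]
    exact Subgroup.FiniteIndex.index_ne_zero
  -- hence so has `P^{r x_i} ⊇ R_j ∩ P^{x_j}`
  have hc : (P.map (MulAut.conj x_i).toMonoidHom).map (MulAut.conj r).toMonoidHom =
      P.map (MulAut.conj (r * x_i)).toMonoidHom := by
    rw [Subgroup.map_map]
    congr 1
    ext x; simp [mul_assoc]
  rw [hc] at hle
  have hfin₂ : (P.map (MulAut.conj (r * x_i)).toMonoidHom).relIndex
      (P.map (MulAut.conj x_j).toMonoidHom) ≠ 0 := by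
    intro h0
    exact hfin₁ (Subgroup.relIndex_eq_zero_of_le_left hle h0)
  -- conjugate back by `x_j` and apply aloofness
  rw [relIndex_map_conj_map_conj] at hfin₂
  have hmem : x_j⁻¹ * (r * x_i) ∈ P := mem_of_relIndex_conj_ne_zero haloof hfin₂
  -- `x_j = r · x_i · p⁻¹` with `p = x_j⁻¹ r x_i ∈ P`
  refine Set.mem_mul.mpr ⟨r * x_i, Set.mem_mul.mpr ⟨r, hr, x_i, rfl, rfl⟩, (x_j⁻¹ * (r * x_i))⁻¹,
    P.inv_mem hmem, ?_⟩
  simp [mul_assoc]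

/-- The same, as an equality of double cosets `R_i x_j P = R_i x_i P`. [cite: MochizukiSemiAnbd2006, Def. 2.2(i) p.23] -/
theorem doubleCoset_eq_of_inf_conj_le {R_i R_j P : Subgroup G} [R_j.FiniteIndex]
    (haloof : ∀ g : G, g ∉ P → (P.map (MulAut.conj g).toMonoidHom).relIndex P = 0)
    {x_i x_j r : G} (hr : r ∈ R_i)
    (hle : R_j ⊓ P.map (MulAut.conj x_j).toMonoidHom ≤
      (P.map (MulAut.conj x_i).toMonoidHom).map (MulAut.conj r).toMonoidHom) :
    DoubleCoset.mk R_i P x_j = DoubleCoset.mk R_i P x_i := by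
  obtain ⟨_, ⟨s, hs, _, rfl, rfl⟩, p, hp, hx⟩ :=
    Set.mem_mul.mp (mem_doubleCoset_of_inf_conj_le haloof hr hle)
  rw [DoubleCoset.eq]
  exact ⟨s⁻¹, R_i.inv_mem hs, p⁻¹, P.inv_mem hp, by rw [← hx]; simp [mul_assoc]⟩

end Literature.AnabelianGeometry.SemiGraphs
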